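import Mathlib
import Literature.Computability.AlgebraicComplexity.BorderRankRestriction
import Literature.Computability.AlgebraicComplexity.GroupAlgebraTensor

/-!
# Stub `stub_borderRank_matMul` for line `Sketch` of crux `FixedPointFreeTargets`
(stmt-MatrixMultiplication-15042)

The matrix multiplication tensor `M = ⟨n,n,n⟩` written on the index set `I × I`,
`I = Fin k → ZMod p` (`|I| = p^k`), has the same border rank as the tree's
`matMulTensor ℂ (p^k) (p^k) (p^k)` (indices `Fin (p^k) × Fin (p^k)`): relabel the coordinates
along a bijection `I ≃ Fin (p^k)` (`algBorderRank_reindex`).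
-/

set_option linter.dupNamespace false

noncomputable section

namespace Summit.MatrixMultiplication.MatrixMultiplication.Theorems

open Literature.Computability.AlgebraicComplexity

namespace PauliTautologicalTarget

/-- `bR` of `⟨n,n,n⟩` written on `I × I`, `I = Fin k → ZMod p`, is `bR ⟨p^k,p^k,p^k⟩`
(relabel along `I ≃ Fin (p^k)`). -/
theorem stub_borderRank_matMul (p k : ℕ) [Fact p.Prime] :
    algBorderRank (fun a b c : (Fin k → ZMod p) × (Fin k → ZMod p) =>
        if a.1 = b.1 ∧ b.2 = c.1 ∧ a.2 = c.2 then (1 : ℂ) else 0) =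
      algBorderRank (matMulTensor ℂ (p ^ k) (p ^ k) (p ^ k)) := by
  have hcard : Fintype.card (Fin k → ZMod p) = p ^ k := by simp [ZMod.card]
  obtain ⟨e⟩ : Nonempty ((Fin k → ZMod p) ≃ Fin (p ^ k)) := ⟨Fintype.equivFinOfCardEq hcard⟩
  have hMe : (fun a b c : (Fin k → ZMod p) × (Fin k → ZMod p) =>
        if a.1 = b.1 ∧ b.2 = c.1 ∧ a.2 = c.2 then (1 : ℂ) else 0) = fun a b c =>
      matMulTensor ℂ (p ^ k) (p ^ k) (p ^ k) (Equiv.prodCongr e e a) (Equiv.prodCongr e e b)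
        (Equiv.prodCongr e e c) := by
    funext a b c
    simp [matMulTensor, EmbeddingLike.apply_eq_iff_eq]
  rw [hMe]
  exact algBorderRank_reindex (Equiv.prodCongr e e) (Equiv.prodCongr e e) (Equiv.prodCongr e e)
    (matMulTensor ℂ (p ^ k) (p ^ k) (p ^ k))

end PauliTautologicalTarget

end Summit.MatrixMultiplication.MatrixMultiplication.Theorems

end
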